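import Literature.AnabelianGeometry.EtaleTheta.EtaleThetaDataHalfCarrier
import Literature.AnabelianGeometry.EtaleTheta.SettingModelChiThetaCocycle
import Literature.AnabelianGeometry.EtaleTheta.Discharge.Sec1Rmk131ModelChiNoHalf
import HarnessLib

/-!
# [EtTh] Prop. 1.3 / Rmk. 1.3.1 with REAL `½`-coefficients, DECIDED at the χ-twisted root model for the model's
# theta class `η̈^Θ = etaDdχ`: `Prop13` HOLDS with content, `Rmk131` FAILS — because the model's class descends to `Y`

S. Mochizuki, *The étale theta function and its Frobenioid-theoretic manifestations*, Publ. RIMS **45**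
(2009), §1, Prop. 1.3 pp. 19–21 and Rmk. 1.3.1 p. 21 (printed 245–247): "the denominators `½` in
Proposition 1.3 are by no means superfluous … the divisor `D₁` on `Ÿ` clearly does not descend to `Y`"
[cite: MochizukiEtTh2009, Rmk 1.3.1 p.21]. Layer L2 of the abc-iut cell, seat abc-iut-L2-t1 (gen 11;
abc-iut-L2-lead R1091 «GO L2-t1 HALF-CARRIER», lane A). PROOF-ONLY companion (no `def`, no instance, no `Prop`
fact) of `EtaleThetaDataHalfCarrier.lean` (this seat: the constructor `KummerData.etaleThetaDataHalf E₀ η̈ e` with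
REAL `½`-groups — `H¹(−, ½Δ_Θ) := H¹(−, Δ_Θ)` with `ofIntegral := x ↦ x²`, levels `Δ_Θ/(2N)·Δ_Θ`, real
restrictions) over abc-iut-L2-d1's theta cocycle of the χ-model (`SettingModelChiThetaCocycle`: `etaχ ∈
H¹(Π^tp_Y, Δ_Θ)`, `etaDdχ := etaχ|_Ÿ`, `thetaCocycleFunχ_mem_lDeltaTheta_of_mem_Huuχ`) and abc-iut-f-117's
no-invariants lemma (`Sec1Rmk131ModelChiNoHalf`: `deltaTheta_eq_one_of_forall_gtpYdd_conj_eq`).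

RESULTS.
* `KummerData.not_rmk131_half_of_prop13` (GENERIC over any `ThetaSetting`): if every `K̈`-unit squares into `K`
  (e.g. `K = K̈`), restriction `H¹(Π^tp_Y, Δ_Θ) → H¹(Π^tp_Ÿ, Δ_Θ)` is injective and `η̈` EXTENDS to `Y`
  (`η̈ = e₀|_Ÿ`), then `Prop13 → ¬ Rmk131` at the half-carrier data — the kernel form of print's reason: with the
  REAL `½`-groups, `Prop13 ∧ Rmk131` FORCES `η̈^Θ` NOT to descend to `Y` («`D₁` does not descend to `Y`»).
* AT `ThetaSetting.modelχ p`, for EVERY Kummer datum `E₀` of the model and the model's theta class `etaDdχ`: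
  - `SettingModel.prop13_half_modelχ` — **`Prop13` HOLDS, WITH CONTENT**, for the canonical `Y`-class
    `e := etaχ²` ("`2·η^Θ`"): `eta_res_Ydd` is `etaχ²|_Ÿ = etaDdχ²`; **`resZN_etaN` is a genuine computation** —
    on `Π^tp_{Z̈_N} ⊆ Π^tp_{Z_N}` the theta cocycle is `N·Δ_Θ`-valued (its level-`N` Heisenberg image is trivial,
    so it lies in abc-iut-L2-d1's `Π^tp_X̲̲(N)`), hence its square is `(2N)·Δ_Θ`-valued and the reduced class dies
    (`ContH1.reduce_mk_eq_one_of_forall_mem`) — print's "`η^Θ_N` arises from a class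
    `∈ H¹(Π^tp_Y/Π^tp_{Z̈_N}, Δ_Θ ⊗ ½ℤ/Nℤ)`";
  - `SettingModel.not_rmk131_half_modelχ` — **`Rmk131` FAILS** for that datum (`e = etaχ²` is a square over `Y`);
  - `SettingModel.not_rmk131_of_prop13_half_modelχ` — and for EVERY choice of the `Y`-class `e`:
    `Prop13 → ¬Rmk131` (the model has `K = K̈ = ℚ_p`, injective restriction `res_gtpYdd_injective_H1_modelχ`, and
    `etaDdχ = etaχ|_Ÿ` BY CONSTRUCTION) — **Rmk. 1.3.1 is DECIDED (FALSE) at `modelχ` for `etaDdχ`**, the reason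
    being exactly the printed one read backwards: the semi-synthetic model's theta class DESCENDS to `Y` (it is
    defined by a cocycle on all of `Π^tp_Y`; cf. the known label «`etaDdχ` is sign-blind under `ε_μ`»,
    abc-iut-w6-d049 `conj_inl_b_etaDdχ`), whereas print's `η̈^Θ` does not (`Θ̈(−Ü) = −Θ̈(Ü)`: the deck
    transformation of `Ÿ → Y` moves the Kummer class of `Θ̈` by the class of `−1`).
  - `SettingModel.exists_half_prop13_and_not_rmk131_modelχ` — census ∃-form.
So, with the printed semantics restored, the E-indexed census at `(modelχ, etaDdχ)` reads «Prop13: HOLDS WITH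
CONTENT (all four clauses; two by computation) · Rmk131: FALSE (model label: `η̈^Θ(modelχ)` descends to `Y`)»;
the degenerate-data tokens of abc-iut-L2-t6 / abc-iut-f-117 (`EtaleThetaDataOfClass`,
`Sec1Rmk131ModelChiThetaData`) are thereby explained, not contradicted. HONEST FRAMING: statements about the
semi-synthetic χ-model and about the typed interface; nothing of [EtTh] is asserted; no side is taken on
[IUTchIII] Cor. 3.12; typed ≠ proved.
-/

noncomputable section

namespace Literature.AnabelianGeometry.EtaleTheta

open scoped IsMulCommutative

/-! ### Generic: with real `½`-groups, `Prop13 ∧ Rmk131` forces non-descent of `η̈^Θ` to `Y` -/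

namespace ThetaSetting.KummerData

variable {p : ℕ} [Fact p.Prime] {D : ThetaSetting p} (E₀ : D.KummerData) (η : D.H1 D.GtpYdd) (e : D.H1 D.GtpY)

/-- **Why the `½` encodes NON-DESCENT of `η̈^Θ` to `Y`** (print's reason for Rmk. 1.3.1: "the divisor `D₁` on
`Ÿ` clearly does not descend to `Y`", p. 21) — kernel form: suppose (i) every `K̈`-unit squares into `K`
(e.g. `K = K̈`, Def. 1.7 (I)), (ii) restriction `H¹(Π^tp_Y, Δ_Θ) → H¹(Π^tp_Ÿ, Δ_Θ)` is injective, and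
(iii) `η̈` EXTENDS to `Y` (`η̈ = e₀|_Ÿ`). Then Prop. 1.3 forces `e = κ_Y(u²)·e₀²`, so Rmk. 1.3.1 FAILS. Hence, under
(i)–(ii), `Prop13 ∧ Rmk131` can only hold for a class `η̈` that does NOT descend to `Y`.
[cite: MochizukiEtTh2009, Rmk 1.3.1 p.21] -/
theorem not_rmk131_half_of_prop13
    (hK : ∀ u ∈ D.unitsOKdd, ((u : D.Kdd) : PadicAlgCl p) ^ 2 ∈ D.K)
    (hinj : Function.Injective (ContH1.res D.toTheta D.DeltaTheta D.GtpYdd_le_GtpY))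
    (e₀ : D.H1 D.GtpY) (hη : ContH1.res D.toTheta D.DeltaTheta D.GtpYdd_le_GtpY e₀ = η)
    (hP : Prop13 (E₀.etaleThetaDataHalf η e)) : ¬ Rmk131 (E₀.etaleThetaDataHalf η e) := by
  obtain ⟨⟨x, hxmem, hx⟩, -⟩ := (E₀.prop13_half_iff η e).mp hP
  -- `x = k · η̈` with `k = infl κ̈(u)` for a unit `u ∈ O^×_K̈`, which squares into `K`
  obtain ⟨k, hk, rfl⟩ := hxmem
  obtain ⟨_, ⟨u, hu, rfl⟩, rfl⟩ := hk
  let a : D.unitsOKmodKdd := ⟨u, hu, hK u hu⟩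
  refine E₀.not_rmk131_half_of_eq η e a e₀ (hinj ?_)
  rw [map_mul, map_pow, res_kumSqY, hη, hx, mul_pow]
  rfl

end ThetaSetting.KummerData

/-! ### At the χ-twisted root model -/

namespace SettingModel

open Literature.AnabelianGeometry.SemiGraphs

variable (p : ℕ) [Fact p.Prime]

/-- `Π^tp_{Z_N}(modelχ) ⊆ Π^tp_X̲̲(N)` (abc-iut-L2-d1's `Huuχ p N`): an element of `Π^tp_{Z_N}` has TRIVIAL
level-`N` Heisenberg image, in particular `x = z = 0 (mod N)`. [cite: MochizukiEtTh2009, §1 p.14] -/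
theorem mem_Huuχ_of_mem_GtpZN (N : ℕ+) {g : PiTpχ p} (hg : g ∈ (ThetaSetting.modelχ p).GtpZN N) :
    g ∈ Huuχ p N := by
  obtain ⟨hleft, -⟩ := ((chiTwistData p).mem_ZN).mp hg
  obtain ⟨-, hker⟩ := Subgroup.mem_inf.mp hleft
  rw [mem_Huuχ_iff, MonoidHom.mem_ker.mp hker]
  exact ⟨Heis.one_x, Heis.one_z⟩

/-- Hence `Π^tp_{Z̈_N}(modelχ) ⊆ Π^tp_X̲̲(N)`. [cite: MochizukiEtTh2009, §1 p.17] -/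
theorem mem_Huuχ_of_mem_GtpZddN (N : ℕ+) {g : PiTpχ p} (hg : g ∈ (ThetaSetting.modelχ p).GtpZddN N) :
    g ∈ Huuχ p N :=
  mem_Huuχ_of_mem_GtpZN p N (Subgroup.mem_inf.mp hg).2

/-- **On `Π^tp_{Z̈_N}` the SQUARE of the theta cocycle is `(2N)·Δ_Θ`-valued** (the cocycle itself is
`N·Δ_Θ`-valued there, abc-iut-L2-d1's `thetaCocycleFunχ_mem_lDeltaTheta_of_mem_Huuχ`).
[cite: MochizukiEtTh2009, Prop 1.3 p.20] -/
theorem thetaCocycleFunχ_sq_mem_lDeltaTheta_of_mem_GtpZddN (N : ℕ+) (g : ↥(ThetaSetting.modelχ p).GtpY)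
    (hg : (g : PiTpχ p) ∈ (ThetaSetting.modelχ p).GtpZddN N) :
    (((thetaCocycleFunχ p g * thetaCocycleFunχ p g : ↥(ThetaSetting.modelχ p).DeltaTheta)) :
        (ThetaSetting.modelχ p).GtpTheta) ∈ (ThetaSetting.modelχ p).lDeltaTheta (2 * (N : ℕ)) := by
  obtain ⟨y, hy, hyN⟩ := thetaCocycleFunχ_mem_lDeltaTheta_of_mem_Huuχ p N g (mem_Huuχ_of_mem_GtpZddN p N hg)
  refine ⟨y, hy, ?_⟩
  rw [Subgroup.coe_mul, ← hyN, two_mul, pow_add]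

/-- **The `Z̈_N`-clause of Prop. 1.3, COMPUTED at the χ-model**: the class `etaχ²` ("`2·η^Θ`"), restricted to
`Π^tp_{Z̈_N}` and reduced modulo `(2N)·Δ_Θ` (= coefficients `Δ_Θ ⊗ ½ℤ/Nℤ`), is trivial — print's "`η^Θ_N`
arises from a class `∈ H¹(Π^tp_Y/Π^tp_{Z̈_N}, Δ_Θ ⊗ ½ℤ/Nℤ)`" (p. 20). [cite: MochizukiEtTh2009, Prop 1.3 p.20] -/
theorem reduceMod_res_etaχ_sq (N : ℕ+) :
    (ThetaSetting.modelχ p).reduceMod (2 * N) ((ThetaSetting.modelχ p).GtpZddN N)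
      (ContH1.res (ThetaSetting.modelχ p).toTheta (ThetaSetting.modelχ p).DeltaTheta
        ((ThetaSetting.modelχ p).GtpZddN_le_GtpY N) (etaχ p ^ 2)) = 1 := by
  rw [map_pow, etaχ]
  change (ThetaSetting.modelχ p).reduceMod (2 * N) ((ThetaSetting.modelχ p).GtpZddN N)
      (ContH1.mk _ (ContH1.resCocycle (ThetaSetting.modelχ p).toTheta (ThetaSetting.modelχ p).DeltaTheta
        ((ThetaSetting.modelχ p).GtpZddN_le_GtpY N) (thetaCocycleχ p)).2 ^ 2) = 1
  rw [pow_two, ContH1.mk_mul_mk]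
  haveI := (ThetaSetting.modelχ p).lDeltaTheta_normal (2 * (N : ℕ))
  exact ContH1.reduce_mk_eq_one_of_forall_mem (ThetaSetting.modelχ p).toTheta (ThetaSetting.modelχ p).DeltaTheta
    ((ThetaSetting.modelχ p).lDeltaTheta (2 * (N : ℕ))) ((ThetaSetting.modelχ p).GtpZddN N) _ _ fun g =>
    thetaCocycleFunχ_sq_mem_lDeltaTheta_of_mem_GtpZddN p N
      ⟨g, (ThetaSetting.modelχ p).GtpZddN_le_GtpY N g.2⟩ g.2

variable (E₀ : (ThetaSetting.modelχ p).KummerData)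

/-- **Prop. 1.3 HOLDS, WITH CONTENT, at the χ-model** for the half-carrier datum of the model's theta class:
`η̈ := etaDdχ`, `e := etaχ²` ("`2·η^Θ`") over ANY Kummer datum `E₀` of the model — `eta_res_Ydd`: `etaχ²|_Ÿ =
etaDdχ²`; `resZN_etaN`: `reduceMod_res_etaχ_sq`; the two `toLevel` clauses definitional (as in print).
[cite: MochizukiEtTh2009, Prop 1.3 p.20] -/
theorem prop13_half_modelχ : ThetaSetting.Prop13 (E₀.etaleThetaDataHalf (etaDdχ p) (etaχ p ^ 2)) := by
  refine (E₀.prop13_half_iff (etaDdχ p) (etaχ p ^ 2)).mpr ⟨⟨etaDdχ p,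
    E₀.mem_thetaClasses_etaleThetaDataHalf _ _, by rw [map_pow]; rfl⟩, fun N => ?_⟩
  rw [ContH1.res_reduce]
  exact reduceMod_res_etaχ_sq p N

/-- **Rmk. 1.3.1 FAILS at the χ-model** for that datum: `e = etaχ²` IS a square over `Y` (witness `a = 1`,
`x = etaχ`). [cite: MochizukiEtTh2009, Rmk 1.3.1 p.21] -/
theorem not_rmk131_half_modelχ : ¬ ThetaSetting.Rmk131 (E₀.etaleThetaDataHalf (etaDdχ p) (etaχ p ^ 2)) :=
  E₀.not_rmk131_half_of_eq_sq _ _ (etaχ p) rfl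

/-- **Restriction `H¹(Π^tp_Y, Δ_Θ) → H¹(Π^tp_Ÿ, Δ_Θ)` is INJECTIVE at the χ-model** (inflation–restriction with
`Δ_Θ^{Π^tp_Ÿ} = 1`: conjugation by `Π^tp_Ÿ` runs through `χ(G_K̈)` on `Δ_Θ ≅ Ẑ(χ)`, abc-iut-f-117's
`deltaTheta_eq_one_of_forall_gtpYdd_conj_eq`; the `Π`-level twin of `res_gtpYdd_injective_modelχ`).
[cite: MochizukiEtTh2009, Prop 1.5 p.23] -/
theorem res_gtpYdd_injective_H1_modelχ :
    Function.Injective (ContH1.res (ThetaSetting.modelχ p).toTheta (ThetaSetting.modelχ p).DeltaTheta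
      (ThetaSetting.modelχ p).GtpYdd_le_GtpY) := by
  haveI : (ThetaSetting.modelχ p).GtpYdd.Normal := (ThetaSetting.modelχ p).compat.GtpYdd_normal
  exact ContH1.res_injective_of_forall_fixed_eq_one' _ fun a ha =>
    deltaTheta_eq_one_of_forall_gtpYdd_conj_eq p a fun n hn => by
      obtain ⟨m, hm, rfl⟩ := hn
      exact ha m hm

/-- At the χ-model `K̈ = K (= ℚ_p)`, so every `K̈`-unit squares into `K`. [cite: MochizukiEtTh2009, Def 1.7 p.27] -/
theorem sq_mem_K_of_mem_unitsOKdd_modelχ (u : (↥(ThetaSetting.modelχ p).Kdd)ˣ)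
    (_hu : u ∈ (ThetaSetting.modelχ p).unitsOKdd) :
    (((u : (ThetaSetting.modelχ p).Kdd) : PadicAlgCl p)) ^ 2 ∈ (ThetaSetting.modelχ p).K := by
  refine pow_mem ?_ 2
  have hle : (ThetaSetting.modelχ p).Kdd ≤ (ThetaSetting.modelχ p).K := (ThetaSetting.modelχ_sec2Hyps p).Kdd_eq.le
  exact hle (u : (ThetaSetting.modelχ p).Kdd).2

/-- **Rmk. 1.3.1 is DECIDED (FALSE) at the χ-model for the model's theta class, for EVERY choice of the
`Y`-class `e`**: whenever the half-carrier datum `(E₀, etaDdχ, e)` satisfies Prop. 1.3, Rmk. 1.3.1 fails — because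
`etaDdχ = etaχ|_Ÿ` DESCENDS to `Y` (print's reason read backwards: at the model the `½` IS superfluous).
[cite: MochizukiEtTh2009, Rmk 1.3.1 p.21] -/
theorem not_rmk131_of_prop13_half_modelχ (e : (ThetaSetting.modelχ p).H1 (ThetaSetting.modelχ p).GtpY)
    (hP : ThetaSetting.Prop13 (E₀.etaleThetaDataHalf (etaDdχ p) e)) :
    ¬ ThetaSetting.Rmk131 (E₀.etaleThetaDataHalf (etaDdχ p) e) :=
  E₀.not_rmk131_half_of_prop13 (etaDdχ p) e (sq_mem_K_of_mem_unitsOKdd_modelχ p)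
    (res_gtpYdd_injective_H1_modelχ p) (etaχ p) rfl hP

/-- **Census ∃-form at `(modelχ, η̈ := etaDdχ ≠ 1)` with REAL `½`-groups**: an étale-theta datum carrying the
model's NON-TRIVIAL theta class at which Prop. 1.3 holds with content and Rmk. 1.3.1 fails; and no half-carrier
datum over `etaDdχ` has both. [cite: MochizukiEtTh2009, Rmk 1.3.1 p.21] -/
theorem exists_half_prop13_and_not_rmk131_modelχ :
    (∃ E : (ThetaSetting.modelχ p).EtaleThetaData, E.toKummerData = E₀ ∧ E.etaDd = etaDdχ p ∧ E.etaDd ≠ 1 ∧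
        ThetaSetting.Prop13 E ∧ ¬ ThetaSetting.Rmk131 E) ∧
      ∀ e : (ThetaSetting.modelχ p).H1 (ThetaSetting.modelχ p).GtpY,
        ThetaSetting.Prop13 (E₀.etaleThetaDataHalf (etaDdχ p) e) →
          ¬ ThetaSetting.Rmk131 (E₀.etaleThetaDataHalf (etaDdχ p) e) :=
  ⟨⟨E₀.etaleThetaDataHalf (etaDdχ p) (etaχ p ^ 2), rfl, rfl, etaDdχ_ne_one p, prop13_half_modelχ p E₀,
      not_rmk131_half_modelχ p E₀⟩,
    not_rmk131_of_prop13_half_modelχ p E₀⟩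

end SettingModel

end Literature.AnabelianGeometry.EtaleTheta

end
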